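import Summits.MatrixMultiplication.OmegaCensus.SmallFormats.MatMul22nRankGF2LowerBound
import Mathlib.Algebra.GroupWithZero.Units.Fintype
import HarnessLib

/-!
# ω-census family (a): the family of ALL dual-type planes of `M₂(𝔽_q)` and their incidences (any finite field)

Cell `pub-omega` (unit `pub-omega-tensor-g6`), topic `Summits/MatrixMultiplication/OmegaCensus`
(sub-folder `SmallFormats`). Framing (verbatim): lottery ticket; floor = certified bounds/negative ranges.
HONEST FRAMING: infrastructure for the kernel re-derivation of the Alekseev–Nazarov bound
`(q²+2)·R_𝔽_q(⟨2,2,n⟩) ≥ 3(q²+3)·n` (file `MatMul22nRankFiniteField`); no bound on any rank here, not progress on `ω`.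

CONTENT. Points of `P¹(k)` are represented by `(1,c)` (`c ∈ k`) and `(0,1)`, each with a fixed complement.
For `x, y ∈ P¹` and `μ ∈ k^×` the plane `span(x yᵀ, x ỹᵀ + μ x̃ yᵀ)` is sandwich-equivalent to the dual-number
plane `span(I, E₀₁)`; we give the explicit un-sandwiches (`famPlane : JIdx k → JPlane k`), so ENG2's module lemma
applies to each member via `JPlane.three_mul_add_card_le`. Incidences, by explicit injections (no `decide`):
an invertible X-matrix `u` annihilates at least `q + 1` members (for every `x` one `(y, μ)`:
`card_option_le_card_perp`), a singular one at least `q − 1` (`x, y` = kernel representatives, `μ` free: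
`card_units_le_card_perp`), and a singular `u` lies on the row plane `{x₀ zᵀ}` of its left-kernel representative
(`one_le_card_rowVan`).
-/

namespace Summit.MatrixMultiplication.OmegaCensus.SmallFormats
open Matrix Literature.Computability.AlgebraicComplexity


section FF
variable {k : Type*} [Field k]

/-- Representatives of `P¹(k)`: `(1, c)` for `c ∈ k` and `(0, 1)`. -/
def p1rep : Option k → Fin 2 → k
  | some c => ![1, c]
  | none => ![0, 1]
/-- A fixed complement of each representative (`(0,1)` resp. `(1,0)`). -/
def p1comp : Option k → Fin 2 → k
  | some _ => ![0, 1]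
  | none => ![1, 0]

/-- A representative is nonzero. -/
theorem p1rep_ne_zero (o : Option k) : p1rep o ≠ 0 := by
  cases o with
  | none => intro h; have := congr_fun h 1; simp [p1rep] at this
  | some c => intro h; have := congr_fun h 0; simp [p1rep] at this

/-- `x · w = 0` and `x̃ · w = 0` force `w = 0`. -/
theorem eq_zero_of_rep_comp (o : Option k) (w : Fin 2 → k) (h1 : p1rep o ⬝ᵥ w = 0)
    (h2 : p1comp o ⬝ᵥ w = 0) : w = 0 := by
  cases o with
  | none =>
    simp [p1rep, p1comp, dotProduct, Fin.sum_univ_two] at h1 h2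
    ext i; fin_cases i <;> simp [h1, h2]
  | some c =>
    simp [p1rep, p1comp, dotProduct, Fin.sum_univ_two] at h1 h2
    rw [h2, mul_zero, add_zero] at h1
    ext i; fin_cases i <;> simp [h1, h2]

/-- The X-matrix of a coefficient function. -/
def xMat (u : Fin 2 × Fin 2 → k) : Matrix (Fin 2) (Fin 2) k := fun i j => u (i, j)

/-- `dotX u (x yᵀ) = (xᵀ U) · y`. -/
theorem dotX_vecMulVec_eq (u : Fin 2 × Fin 2 → k) (x y : Fin 2 → k) :
    dotX u (vecMulVec x y) = (x ᵥ* xMat u) ⬝ᵥ y := by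
  rw [dotX_eq]
  simp [vecMulVec_apply, Matrix.vecMul, dotProduct, Fin.sum_univ_two, xMat]
  ring

/-- `dotX u` is additive in the matrix. -/
theorem dotX_add (u : Fin 2 × Fin 2 → k) (A B : Matrix (Fin 2) (Fin 2) k) :
    dotX u (A + B) = dotX u A + dotX u B := by
  simp only [dotX_eq, Matrix.add_apply]; ring

/-- `dotX u` is homogeneous in the matrix. -/
theorem dotX_smul (u : Fin 2 × Fin 2 → k) (s : k) (A : Matrix (Fin 2) (Fin 2) k) :
    dotX u (s • A) = s * dotX u A := by
  simp only [dotX_eq, Matrix.smul_apply, smul_eq_mul]; ring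

/-- `2×2` Cramer: `U y = 0` with `det U ≠ 0` forces `y = 0`. -/
theorem eq_zero_of_mulVec_eq_zero (u : Fin 2 × Fin 2 → k) (hdet : u (0, 0) * u (1, 1) - u (0, 1) * u (1, 0) ≠ 0)
    (y : Fin 2 → k) (h : xMat u *ᵥ y = 0) : y = 0 := by
  have h0 := congr_fun h 0
  have h1 := congr_fun h 1
  simp [Matrix.mulVec, dotProduct, Fin.sum_univ_two, xMat] at h0 h1
  have e0 : (u (0, 0) * u (1, 1) - u (0, 1) * u (1, 0)) * y 0 = 0 := by linear_combination u (1, 1) * h0 - u (0, 1) * h1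
  have e1 : (u (0, 0) * u (1, 1) - u (0, 1) * u (1, 0)) * y 1 = 0 := by linear_combination u (0, 0) * h1 - u (1, 0) * h0
  ext i; fin_cases i
  · exact (mul_eq_zero.1 e0).resolve_left hdet
  · exact (mul_eq_zero.1 e1).resolve_left hdet

/-- `xᵀ U = 0` with `det U ≠ 0` forces `x = 0`. -/
theorem eq_zero_of_vecMul_eq_zero (u : Fin 2 × Fin 2 → k) (hdet : u (0, 0) * u (1, 1) - u (0, 1) * u (1, 0) ≠ 0)
    (x : Fin 2 → k) (h : x ᵥ* xMat u = 0) : x = 0 := by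
  have h0 := congr_fun h 0
  have h1 := congr_fun h 1
  simp [Matrix.vecMul, dotProduct, Fin.sum_univ_two, xMat] at h0 h1
  have e0 : (u (0, 0) * u (1, 1) - u (0, 1) * u (1, 0)) * x 0 = 0 := by linear_combination u (1, 1) * h0 - u (1, 0) * h1
  have e1 : (u (0, 0) * u (1, 1) - u (0, 1) * u (1, 0)) * x 1 = 0 := by linear_combination u (0, 0) * h1 - u (0, 1) * h0
  ext i; fin_cases i
  · exact (mul_eq_zero.1 e0).resolve_left hdet
  · exact (mul_eq_zero.1 e1).resolve_left hdet

/-! ### The family of all dual-type planes -/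
/-- An outer product of `2`-vectors, written out. -/
theorem vecMulVec_two (a b c d : k) : vecMulVec ![a, b] ![c, d] = !![a * c, a * d; b * c, b * d] := by
  ext i j; fin_cases i <;> fin_cases j <;> simp [vecMulVec_apply]
/-- Scalar multiple of a `2×2` matrix, written out. -/
theorem smul_two (s a b c d : k) : s • !![a, b; c, d] = !![s * a, s * b; s * c, s * d] := by
  ext i j; fin_cases i <;> fin_cases j <;> simp
/-- Sum of `2×2` matrices, written out. -/
theorem add_two (a b c d e f g h : k) : !![a, b; c, d] + !![e, f; g, h] = !![a + e, b + f; c + g, d + h] := by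
  ext i j; fin_cases i <;> fin_cases j <;> simp

/-- Index of the family of dual-type planes: `(x, y) ∈ P¹ × P¹` and `μ ∈ k^×`. -/
abbrev JIdx (k : Type*) [Field k] := Option k × Option k × kˣ

/-- First generator `M = x ỹᵀ + μ x̃ yᵀ` (goes to `I`). -/
def famM (p : JIdx k) : Matrix (Fin 2) (Fin 2) k :=
  vecMulVec (p1rep p.1) (p1comp p.2.1) + (p.2.2 : k) • vecMulVec (p1comp p.1) (p1rep p.2.1)
/-- Second generator `N = x yᵀ` (goes to `E₀₁`). -/
def famN (p : JIdx k) : Matrix (Fin 2) (Fin 2) k := vecMulVec (p1rep p.1) (p1rep p.2.1)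
/-- `diag(1, m) · [x | x̃]⁻¹` (left un-sandwich, `m = μ⁻¹`). -/
def lInv (m : k) : Option k → Matrix (Fin 2) (Fin 2) k
  | some c => !![1, 0; -(m * c), m]
  | none => !![0, 1; m, 0]
/-- `[ỹᵀ ; yᵀ]⁻¹` (right un-sandwich). -/
def rInv : Option k → Matrix (Fin 2) (Fin 2) k
  | some d => !![-d, 1; 1, 0]
  | none => !![1, 0; 0, 1]
/-- Left un-sandwich of the plane `p`. -/
def famP' (p : JIdx k) : Matrix (Fin 2) (Fin 2) k := lInv ((p.2.2 : k)⁻¹) p.1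
/-- Right un-sandwich of the plane `p`. -/
def famQ' (p : JIdx k) : Matrix (Fin 2) (Fin 2) k := rInv p.2.1

/-- The un-sandwiches take `M` to `I`. -/
theorem famM_ok (p : JIdx k) : famP' p * famM p * famQ' p = 1 := by
  obtain ⟨ox, oy, μ⟩ := p
  cases ox with
  | none => cases oy with
    | none =>
      simp only [famP', famM, famQ', lInv, rInv, p1rep, p1comp, vecMulVec_two, smul_two, add_two,
        Matrix.mul_fin_two, Matrix.one_fin_two]
      ext i j; fin_cases i <;> fin_cases j <;> simp
    | some d =>
      simp only [famP', famM, famQ', lInv, rInv, p1rep, p1comp, vecMulVec_two, smul_two, add_two,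
        Matrix.mul_fin_two, Matrix.one_fin_two]
      ext i j; fin_cases i <;> fin_cases j <;> simp
  | some c => cases oy with
    | none =>
      simp only [famP', famM, famQ', lInv, rInv, p1rep, p1comp, vecMulVec_two, smul_two, add_two,
        Matrix.mul_fin_two, Matrix.one_fin_two]
      ext i j; fin_cases i <;> fin_cases j <;> simp
    | some d =>
      have hμ : (μ : k) ≠ 0 := μ.ne_zero
      simp only [famP', famM, famQ', lInv, rInv, p1rep, p1comp, vecMulVec_two, smul_two, add_two,
        Matrix.mul_fin_two, Matrix.one_fin_two]
      ext i j; fin_cases i <;> fin_cases j <;> simp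
      field_simp
      ring

/-- The un-sandwiches take `N` to `E₀₁`. -/
theorem famN_ok (p : JIdx k) : famP' p * famN p * famQ' p = E01 := by
  obtain ⟨ox, oy, μ⟩ := p
  have hE : (E01 : Matrix (Fin 2) (Fin 2) k) = !![0, 1; 0, 0] := by
    ext i j; fin_cases i <;> fin_cases j <;> simp [E01]
  rw [hE]
  cases ox with
  | none => cases oy with
    | none =>
      simp only [famP', famN, famQ', lInv, rInv, p1rep, vecMulVec_two, Matrix.mul_fin_two]
      ext i j; fin_cases i <;> fin_cases j <;> simp
    | some d =>
      simp only [famP', famN, famQ', lInv, rInv, p1rep, vecMulVec_two, Matrix.mul_fin_two]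
      ext i j; fin_cases i <;> fin_cases j <;> simp
  | some c => cases oy with
    | none =>
      simp only [famP', famN, famQ', lInv, rInv, p1rep, vecMulVec_two, Matrix.mul_fin_two]
      ext i j; fin_cases i <;> fin_cases j <;> simp
    | some d =>
      have hμ : (μ : k) ≠ 0 := μ.ne_zero
      simp only [famP', famN, famQ', lInv, rInv, p1rep, vecMulVec_two, Matrix.mul_fin_two]
      ext i j; fin_cases i <;> fin_cases j <;> simp
      field_simp
      ring

/-- The family as `JPlane` data. -/
def famPlane (p : JIdx k) : JPlane k := ⟨famM p, famN p, famP' p, famQ' p, famM_ok p, famN_ok p⟩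

/-! ### Incidences -/
variable [DecidableEq k]

/-- The `y`-representative orthogonal to the row vector `v`. -/
def oyOf (v : Fin 2 → k) : Option k := if v 1 = 0 then none else some (-(v 0) / v 1)

/-- `v · y(v) = 0`. -/
theorem dot_oyOf (v : Fin 2 → k) : v ⬝ᵥ p1rep (oyOf v) = 0 := by
  unfold oyOf
  split_ifs with h
  · simp [p1rep, dotProduct, Fin.sum_univ_two, h]
  · simp [p1rep, dotProduct, Fin.sum_univ_two]
    field_simp
    ring

/-- Invertible `u`: for each `x`, an index `(x, y, μ)` of the family annihilated by `u`. -/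
theorem exists_perp_of_det_ne_zero (u : Fin 2 × Fin 2 → k)
    (hdet : u (0, 0) * u (1, 1) - u (0, 1) * u (1, 0) ≠ 0) (ox : Option k) :
    ∃ p : JIdx k, p.1 = ox ∧ dotX u (famM p) = 0 ∧ dotX u (famN p) = 0 := by
  set v := p1rep ox ᵥ* xMat u with hv
  set oy := oyOf v with hoy
  set vt := p1comp ox ᵥ* xMat u with hvt
  have hN : v ⬝ᵥ p1rep oy = 0 := dot_oyOf v
  -- (a) `x̃ᵀ U y ≠ 0`
  have ha : vt ⬝ᵥ p1rep oy ≠ 0 := by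
    intro h0
    have hw : xMat u *ᵥ p1rep oy = 0 := by
      refine eq_zero_of_rep_comp ox _ ?_ ?_
      · rw [Matrix.dotProduct_mulVec, ← hv]; exact hN
      · rw [Matrix.dotProduct_mulVec, ← hvt]; exact h0
    exact p1rep_ne_zero oy (eq_zero_of_mulVec_eq_zero u hdet _ hw)
  -- (b) `xᵀ U ỹ ≠ 0`
  have hb : v ⬝ᵥ p1comp oy ≠ 0 := by
    intro h0
    have hv0 : v = 0 := by
      refine eq_zero_of_rep_comp oy v ?_ ?_
      · rw [dotProduct_comm]; exact hN
      · rw [dotProduct_comm]; exact h0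
    exact p1rep_ne_zero ox (eq_zero_of_vecMul_eq_zero u hdet _ (by rw [← hv]; exact hv0))
  set μv : k := -(v ⬝ᵥ p1comp oy) / (vt ⬝ᵥ p1rep oy) with hμv
  have hμ0 : μv ≠ 0 := by
    rw [hμv]; exact div_ne_zero (neg_ne_zero.2 hb) ha
  refine ⟨(ox, oy, Units.mk0 μv hμ0), rfl, ?_, ?_⟩
  · simp only [famM, Units.val_mk0, dotX_add, dotX_smul, dotX_vecMulVec_eq]
    rw [← hv, ← hvt, hμv]
    field_simp
    ring
  · simp only [famN, dotX_vecMulVec_eq]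
    rw [← hv]; exact hN

/-- Invertible `u`: at least `q + 1` members of the family are annihilated. -/
theorem card_option_le_card_perp [Fintype k] (u : Fin 2 × Fin 2 → k)
    (hdet : u (0, 0) * u (1, 1) - u (0, 1) * u (1, 0) ≠ 0) :
    Fintype.card (Option k) ≤ (Finset.univ.filter fun p : JIdx k => dotX u (famM p) = 0 ∧ dotX u (famN p) = 0).card := by
  classical
  choose f hf1 hf2 hf3 using exists_perp_of_det_ne_zero u hdet
  have hinj : Function.Injective f := fun a b h => by rw [← hf1 a, ← hf1 b, h]
  calc Fintype.card (Option k) = (Finset.univ.image f).card := by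
        rw [Finset.card_image_of_injective _ hinj, Finset.card_univ]
    _ ≤ _ := Finset.card_le_card fun p hp => by
        obtain ⟨a, -, rfl⟩ := Finset.mem_image.1 hp
        simp [hf2 a, hf3 a]

/-- Left kernel representative of a singular `u`. -/
def oxKer (u : Fin 2 × Fin 2 → k) : Option k :=
  if u (1, 0) = 0 ∧ u (1, 1) = 0 then none
  else if u (1, 0) ≠ 0 then some (-(u (0, 0)) / u (1, 0)) else some (-(u (0, 1)) / u (1, 1))

/-- Right kernel representative of a singular `u`. -/
def oyKer (u : Fin 2 × Fin 2 → k) : Option k :=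
  if u (0, 1) = 0 ∧ u (1, 1) = 0 then none
  else if u (0, 1) ≠ 0 then some (-(u (0, 0)) / u (0, 1)) else some (-(u (1, 0)) / u (1, 1))

/-- `x₀ᵀ U = 0` for singular `U`. -/
theorem oxKer_vecMul (u : Fin 2 × Fin 2 → k) (hdet : u (0, 0) * u (1, 1) - u (0, 1) * u (1, 0) = 0) :
    p1rep (oxKer u) ᵥ* xMat u = 0 := by
  unfold oxKer
  ext j
  split_ifs with h1 h2
  · fin_cases j <;> simp [p1rep, Matrix.vecMul, dotProduct, Fin.sum_univ_two, xMat, h1.1, h1.2]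
  · fin_cases j
    · simp [p1rep, Matrix.vecMul, dotProduct, Fin.sum_univ_two, xMat]; field_simp; ring
    · simp [p1rep, Matrix.vecMul, dotProduct, Fin.sum_univ_two, xMat]; field_simp; linear_combination (-1 : k) * hdet
  · have h3 : u (1, 1) ≠ 0 := by
      intro h; simp only [ne_eq, not_not] at h2; exact h1 ⟨h2, h⟩
    simp only [ne_eq, not_not] at h2
    have h00 : u (0, 0) = 0 := by
      have : u (0, 0) * u (1, 1) = 0 := by linear_combination hdet + u (0, 1) * h2
      exact (mul_eq_zero.1 this).resolve_right h3
    fin_cases j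
    · simp [p1rep, Matrix.vecMul, dotProduct, Fin.sum_univ_two, xMat, h2, h00]
    · simp [p1rep, Matrix.vecMul, dotProduct, Fin.sum_univ_two, xMat]; field_simp; ring

/-- `U y₀ = 0` for singular `U`. -/
theorem oyKer_mulVec (u : Fin 2 × Fin 2 → k) (hdet : u (0, 0) * u (1, 1) - u (0, 1) * u (1, 0) = 0) :
    xMat u *ᵥ p1rep (oyKer u) = 0 := by
  unfold oyKer
  ext i
  split_ifs with h1 h2
  · fin_cases i <;> simp [p1rep, Matrix.mulVec, dotProduct, Fin.sum_univ_two, xMat, h1.1, h1.2]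
  · fin_cases i
    · simp [p1rep, Matrix.mulVec, dotProduct, Fin.sum_univ_two, xMat]; field_simp; ring
    · simp [p1rep, Matrix.mulVec, dotProduct, Fin.sum_univ_two, xMat]; field_simp; linear_combination (-1 : k) * hdet
  · have h3 : u (1, 1) ≠ 0 := by
      intro h; simp only [ne_eq, not_not] at h2; exact h1 ⟨h2, h⟩
    simp only [ne_eq, not_not] at h2
    have h00 : u (0, 0) = 0 := by
      have : u (0, 0) * u (1, 1) = 0 := by linear_combination hdet + u (1, 0) * h2
      exact (mul_eq_zero.1 this).resolve_right h3
    fin_cases i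
    · simp [p1rep, Matrix.mulVec, dotProduct, Fin.sum_univ_two, xMat, h2, h00]
    · simp [p1rep, Matrix.mulVec, dotProduct, Fin.sum_univ_two, xMat]; field_simp; ring

/-- Singular `u`: `(xKer, yKer, μ)` is annihilated for every `μ`. -/
theorem perp_of_det_eq_zero (u : Fin 2 × Fin 2 → k) (hdet : u (0, 0) * u (1, 1) - u (0, 1) * u (1, 0) = 0)
    (μ : kˣ) : dotX u (famM (oxKer u, oyKer u, μ)) = 0 ∧ dotX u (famN (oxKer u, oyKer u, μ)) = 0 := by
  have hx := oxKer_vecMul u hdet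
  have hy := oyKer_mulVec u hdet
  constructor
  · simp only [famM, dotX_add, dotX_smul, dotX_vecMulVec_eq]
    rw [hx, zero_dotProduct, zero_add, ← Matrix.dotProduct_mulVec, hy, dotProduct_zero, mul_zero]
  · simp only [famN, dotX_vecMulVec_eq]
    rw [hx, zero_dotProduct]

/-- Singular `u`: at least `q − 1` members of the family are annihilated. -/
theorem card_units_le_card_perp [Fintype k] (u : Fin 2 × Fin 2 → k)
    (hdet : u (0, 0) * u (1, 1) - u (0, 1) * u (1, 0) = 0) :
    Fintype.card kˣ ≤ (Finset.univ.filter fun p : JIdx k => dotX u (famM p) = 0 ∧ dotX u (famN p) = 0).card := by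
  classical
  set f : kˣ → JIdx k := fun μ => (oxKer u, oyKer u, μ) with hf
  have hinj : Function.Injective f := fun a b h => by
    have := congrArg (fun p : JIdx k => p.2.2) h; simpa [hf] using this
  calc Fintype.card kˣ = (Finset.univ.image f).card := by
        rw [Finset.card_image_of_injective _ hinj, Finset.card_univ]
    _ ≤ _ := Finset.card_le_card fun p hp => by
        obtain ⟨μ, -, rfl⟩ := Finset.mem_image.1 hp
        simp [hf, perp_of_det_eq_zero u hdet μ]

/-- Singular `u`: it lies on the row plane of `xKer`. -/
theorem one_le_card_rowVan [Fintype k] (u : Fin 2 × Fin 2 → k)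
    (hdet : u (0, 0) * u (1, 1) - u (0, 1) * u (1, 0) = 0) :
    1 ≤ (Finset.univ.filter fun o : Option k => p1rep o ᵥ* xMat u = 0).card := by
  classical
  exact Finset.one_le_card.2 ⟨oxKer u, by simp [oxKer_vecMul u hdet]⟩

end FF

end Summit.MatrixMultiplication.OmegaCensus.SmallFormats
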